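import Summits.FinalStateConjecture.FinalStateConjecture.Statement
import Literature.Geometry.Lorentzian.TameGenericity
import HarnessLib

/-!
# `EIHFluxBalance.ModulatedKerrHandoff` (item stmt-FinalStateConjecture-17402, H′ — the TAME re-type):
# local kick families, trimmed data and tame trimming families (definitions only; Theses-free)

The vocabulary shared VERBATIM by the two trimming lines of the crux — `Lines/trim_kick_censorship.lean`
(strategist, pieces T / W / K) and `Lines/trim_on_the_cure.lean` (pieces T / C / U) — whose common piece T
(`stub_tameEndTrimming`) and common assembly (`exists_tameCurve_of_kick_trim`, file
`…KickTrimAssembly.lean`) consume it: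

* `IsLocalKick X d G` — a LOCAL KICK FAMILY through the datum `d`: jointly smooth one-parameter family,
  `G 0 = d`, admissible members, agreeing with `d` off ONE compact set (the `Local` legend of route
  LateLocalKicks; Christodoulou's compactly supported witness lines `α₀ + c f`);
* `IsTrimmed e D` — Schwarzschildean on the end `e` to the orders the far-field clauses of the handoff
  ansatz consume (`h − (1 + 2M/r)δ = o₄(r^{-15/8})`, `k = o₃(r^{-23/8})`);
* `IsTameTrimmingFamily X e d M₀ R₀ T M` — a receding end-trimming family of `d` beyond `R₀`: admissible,
  trimmed, Dafermos–Rodnianski flat with a continuous mass `M R → M₀`, equal to `d` off `e.far R`, jointly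
  smooth along smooth radius schedules, and TAME (`e.wDist (T R) d → 0`).

No theorem of substance is claimed (`isLocalKick_const`: the constant family is a local kick family).
-/

noncomputable section

namespace Summit.FinalStateConjecture.FinalStateConjecture.Theorems.EIHFluxBalance.TameTemplate

open scoped Topology Manifold ContDiff ENNReal
open Bundle Filter Set Function TopologicalSpace Literature.Geometry.Lorentzian InitialDataSet

-- D-0017: single-problem summit, `Summit.<S>.<S>.…` by design.
set_option linter.dupNamespace false

/-- **Local kick family** through the datum `d` (verbatim the `Local` legend of route
LateLocalKicks): `G : ℝ¹ → data` jointly smooth (`IsSmoothDataFamily`), `G 0 = d`, every member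
admissible, and ONE compact set `K ⊆ X` off which every member has the sections of `d`.
Christodoulou's compactly supported witness lines `α₀ + c f`. [cite: Christodoulou1999, p. A24] -/
def IsLocalKick (X : Type) [TopologicalSpace X] [ChartedSpace E3 X]
    [IsManifold (𝓡 3) ∞ X] [T2Space X] [SecondCountableTopology X] [ConnectedSpace X]
    (d : InitialDataSet (𝓡 3) X) (G : EuclideanSpace ℝ (Fin 1) → InitialDataSet (𝓡 3) X) : Prop :=
  IsSmoothDataFamily 1 G ∧ G 0 = d ∧ (∀ c, G c ∈ admissibleVacuumData X) ∧
    ∃ K : Set X, IsCompact K ∧ ∀ c, ∀ x ∉ K, (G c).h.inner x = d.h.inner x ∧ (G c).k x = d.k x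

/-- **Trimmed datum on the end `e`**: Schwarzschildean in the chart of `e` to the orders the
far-field clauses of the handoff ansatz consume — `h − (1 + 2M/r)δ = o₄(r^{-15/8})`,
`k = o₃(r^{-23/8})`. Exact Kerr `t`-slice ends (Corvino–Schoen 2006, Thm 2) and harmonic
asymptotics (ibid., Thm 1: `O_∞(r⁻²)`, `O_∞(r⁻³)`) are trimmed. [cite: CorvinoSchoen2006, Thm 1] -/
def IsTrimmed {X : Type} [TopologicalSpace X] [ChartedSpace E3 X] [IsManifold (𝓡 3) ∞ X]
    (e : AFEnd X) (D : InitialDataSet (𝓡 3) X) : Prop :=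
  ∃ M : ℝ, e.IsStronglyAsymptoticallyFlatWith D M (15 / 8) (23 / 8) 4 3

/-- **Tame trimming family** of the datum `d` on the end `e` (mass `M₀`) beyond the radius `R₀`:
for every `R ≥ R₀` the datum `T R` is admissible, trimmed on `e`, Dafermos–Rodnianski flat on `e`
with mass `M R`, and has the sections of `d` at every point off the far region `e.far R`; the family
is jointly smooth along every smooth radius schedule `ρ ≥ R₀`; the mass function is continuous on
`[R₀, ∞)` with `M R → M₀`; and the trimming is TAME: `e.wDist (T R) d → 0` as `R → ∞` (the
Dafermos–Rodnianski weighted `C² × C¹` size of the surgery vanishes — what makes receding trimming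
compatible with `IsTameDataFamily`). Engines: Corvino–Schoen 2006 Thms 1–2, Chruściel–Delay 2003,
made parametric in the radius. [cite: CorvinoSchoen2006, Thm 1] [cite: DafermosRodnianski2013, App. B.2.3] -/
def IsTameTrimmingFamily (X : Type) [TopologicalSpace X] [ChartedSpace E3 X]
    [IsManifold (𝓡 3) ∞ X] [T2Space X] [SecondCountableTopology X] [ConnectedSpace X]
    (e : AFEnd X) (d : InitialDataSet (𝓡 3) X) (M₀ R₀ : ℝ) (T : ℝ → InitialDataSet (𝓡 3) X)
    (M : ℝ → ℝ) : Prop :=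
  (∀ R, R₀ ≤ R → T R ∈ admissibleVacuumData X ∧ IsTrimmed e (T R) ∧
      e.IsStronglyAsymptoticallyFlatDR (T R) (M R) ∧
        ∀ x ∉ e.far R, (T R).h.inner x = d.h.inner x ∧ (T R).k x = d.k x) ∧
    (∀ ρ : EuclideanSpace ℝ (Fin 1) → ℝ, ContDiff ℝ ∞ ρ → (∀ c, R₀ ≤ ρ c) →
      IsSmoothDataFamily 1 (fun c ↦ T (ρ c))) ∧
    ContinuousOn M (Set.Ici R₀) ∧ Tendsto M atTop (𝓝 M₀) ∧
      Tendsto (fun R ↦ e.wDist (T R) d) atTop (𝓝 0)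

/-- The constant family through an admissible datum is a local kick family (empty compact set).
[cite: Christodoulou1999, p. A24] -/
theorem isLocalKick_const :
    ∀ {X : Type} [TopologicalSpace X] [ChartedSpace E3 X] [IsManifold (𝓡 3) ∞ X] [T2Space X] [SecondCountableTopology X] [ConnectedSpace X] {d : InitialDataSet (𝓡 3) X} (hd : d ∈ admissibleVacuumData X), IsLocalKick X d (fun _ ↦ d) := by
  intro X _ _ _ _ _ _ d hd
  exact ⟨isSmoothDataFamily_const 1 d, rfl, fun _ ↦ hd, ∅, isCompact_empty, fun _ _ _ ↦ ⟨rfl, rfl⟩⟩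

end Summit.FinalStateConjecture.FinalStateConjecture.Theorems.EIHFluxBalance.TameTemplate

end
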